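import Literature.Probability.Percolation.TwoSetConditionalAssociation
import HarnessLib

/-!
# Quantitative BHK with vertex SETS: the majorant floor for the cluster of a set `S` given `{S ↮ T}`

Support file (`--supports stmt-CriticalPhenomena-4575`), prover seat `prim-rate-mine-2` (lane prim-rate, constants-miner (c), BENCH row
M2-R10, abstract form with vertex sets).  No definitions, no named facts, no sorries; standard axioms.

The set form of van den Berg–Häggström–Kahn's Theorem 1.3 (tree: `BHK2006_setClusterConditionalPositiveAssociation`, Remark 1 after
their Thm 1.2 / Kozma–Nitzan's quoted form) says that increasing functions of `C_S = ⋃_{s∈S} C_s` are positively correlated given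
`{S ↮ T}`.  As in the one-vertex file (`QuantBHK.condCov_ge_majorant_gap`, …QuantitativeBHKMajorant.lean): if `G` is ANY function with
`F·G̃ = F·G` for an increasing `G̃`, then `(∫_D F)(∫_D G̃) ≤ μ(D)∫_D F·G`, i.e. `Cov_ν(F, G) ≥ E_ν[F]·(E_ν[G̃] − E_ν[G])` — the shape in
which the relay-SET consumers of the lane's separation floor (`CSH.covTransfer_relaySet_edge` and its world-by-world copies) need it.
With `G̃ = G` it is the tree theorem verbatim.
[cite: VandenbergHaggstromKahn2005, Thm. 1.3 (p. 6) with Remark 1 after Thm. 1.2 (p. 5)]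
-/

noncomputable section

namespace Summit.CriticalPhenomena.PercolationContinuityZ3.Theorems

open MeasureTheory Set Literature.Probability.LatticeModels Literature.Probability.Percolation
open scoped Classical

namespace QuantBHK

universe v

variable {V : Type v} [Fintype V]

/-- **Quantitative BHK 1.3 with vertex sets, from a monotone majorant.**  `D = {S ↮ T}`, `C_S = ⋃_{s∈S} C_s` (open edge clusters),
`F, G̃` increasing, `G` any function with `F C * G̃ C = F C * G C` for all `C`: `(∫_D F(C_S))·(∫_D G̃(C_S)) ≤ μ(D)·∫_D F(C_S)·G(C_S)`.
[cite: VandenbergHaggstromKahn2005, Thm. 1.3 (p. 6) with Remark 1 after Thm. 1.2 (p. 5)] -/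
theorem setIntegral_mul_setIntegral_setCluster_majorant_le (w : Sym2 V → unitInterval) (S T : Set V)
    (F G Gt : Set (Sym2 V) → ℝ) (hF : Monotone F) (hGt : Monotone Gt) (hFG : ∀ C, F C * Gt C = F C * G C) :
    (∫ ω in {ω : BondConfig V | ∀ s ∈ S, ∀ t ∈ T, ¬ (openGraph ω).Reachable s t},
        F (⋃ s ∈ S, openEdgeCluster ω s) ∂(prodBernoulli w)) *
      (∫ ω in {ω : BondConfig V | ∀ s ∈ S, ∀ t ∈ T, ¬ (openGraph ω).Reachable s t},
        Gt (⋃ s ∈ S, openEdgeCluster ω s) ∂(prodBernoulli w)) ≤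
    (prodBernoulli w).real {ω : BondConfig V | ∀ s ∈ S, ∀ t ∈ T, ¬ (openGraph ω).Reachable s t} *
      ∫ ω in {ω : BondConfig V | ∀ s ∈ S, ∀ t ∈ T, ¬ (openGraph ω).Reachable s t},
        F (⋃ s ∈ S, openEdgeCluster ω s) * G (⋃ s ∈ S, openEdgeCluster ω s) ∂(prodBernoulli w) := by
  have key := BHK2006_setClusterConditionalPositiveAssociation w S T F Gt hF hGt
  have hfg : (fun ω : BondConfig V => F (⋃ s ∈ S, openEdgeCluster ω s) * Gt (⋃ s ∈ S, openEdgeCluster ω s)) =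
      fun ω => F (⋃ s ∈ S, openEdgeCluster ω s) * G (⋃ s ∈ S, openEdgeCluster ω s) := by
    funext ω; exact hFG _
  rw [hfg] at key
  exact key

/-- **The explicit floor with vertex sets.**  Same hypotheses:
`(∫_D F(C_S))·(∫_D G̃(C_S) − ∫_D G(C_S)) ≤ μ(D)·∫_D F(C_S)G(C_S) − (∫_D F(C_S))(∫_D G(C_S))`, i.e.
`Cov(F(C_S), G(C_S) | S ↮ T) ≥ E[F(C_S) | S↮T]·(E[G̃(C_S) | S↮T] − E[G(C_S) | S↮T])`.
[cite: VandenbergHaggstromKahn2005, Thm. 1.3 (p. 6) with Remark 1 after Thm. 1.2 (p. 5)] -/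
theorem condCov_setCluster_ge_majorant_gap (w : Sym2 V → unitInterval) (S T : Set V)
    (F G Gt : Set (Sym2 V) → ℝ) (hF : Monotone F) (hGt : Monotone Gt) (hFG : ∀ C, F C * Gt C = F C * G C) :
    (∫ ω in {ω : BondConfig V | ∀ s ∈ S, ∀ t ∈ T, ¬ (openGraph ω).Reachable s t},
        F (⋃ s ∈ S, openEdgeCluster ω s) ∂(prodBernoulli w)) *
      ((∫ ω in {ω : BondConfig V | ∀ s ∈ S, ∀ t ∈ T, ¬ (openGraph ω).Reachable s t},
          Gt (⋃ s ∈ S, openEdgeCluster ω s) ∂(prodBernoulli w)) -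
        ∫ ω in {ω : BondConfig V | ∀ s ∈ S, ∀ t ∈ T, ¬ (openGraph ω).Reachable s t},
          G (⋃ s ∈ S, openEdgeCluster ω s) ∂(prodBernoulli w)) ≤
    (prodBernoulli w).real {ω : BondConfig V | ∀ s ∈ S, ∀ t ∈ T, ¬ (openGraph ω).Reachable s t} *
        (∫ ω in {ω : BondConfig V | ∀ s ∈ S, ∀ t ∈ T, ¬ (openGraph ω).Reachable s t},
          F (⋃ s ∈ S, openEdgeCluster ω s) * G (⋃ s ∈ S, openEdgeCluster ω s) ∂(prodBernoulli w)) -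
      (∫ ω in {ω : BondConfig V | ∀ s ∈ S, ∀ t ∈ T, ¬ (openGraph ω).Reachable s t},
          F (⋃ s ∈ S, openEdgeCluster ω s) ∂(prodBernoulli w)) *
        ∫ ω in {ω : BondConfig V | ∀ s ∈ S, ∀ t ∈ T, ¬ (openGraph ω).Reachable s t},
          G (⋃ s ∈ S, openEdgeCluster ω s) ∂(prodBernoulli w) := by
  have key := setIntegral_mul_setIntegral_setCluster_majorant_le w S T F G Gt hF hGt hFG
  nlinarith [key]

end QuantBHK

end Summit.CriticalPhenomena.PercolationContinuityZ3.Theorems
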